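/-
Copyright (c) 2026. All rights reserved.
Released under Apache 2.0 license as described in the file LICENSE.
Authors: abc-iut cell, seat abc-iut-L6-t19 (gen 21 scratch; filed gen 24; PROGRAMME P-L2 rung (L3′), slice 1: CLAIM M).
-/
import Literature.AnabelianGeometry.EtaleTheta.SettingModelFoxLevelTorus
import Literature.AnabelianGeometry.EtaleTheta.SettingModelChiShearInner
import Mathlib.Topology.Algebra.ClopenNhdofOne
import HarnessLib

/-!
# The pure-Kummer operators `Inn(b^t) ∘ s_{2t}` of `F̂₂` stabilise no `b`-line except `b^Ẑ` itself (CLAIM M)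

Classical profinite group theory about the SEMI-SYNTHETIC model `F̂₂ = F₂hatT` of
Mochizuki, *The étale theta function …* [EtTh] §1, PRIMS PDF p. 13 [cite: MochizukiEtTh2009, §1 p.13]
("`G_{K_N}` acts trivially on `(Δ^tp_X)^ell/N·(Δ^tp_Y)^ell`" — the affine Galois action `a ↦ a·b^k, b ↦ b^u`,
modelled by abc-iut-L2-t6's `shear` / abc-iut-L2-t5's `innB`), read through Fox's free differential calculus in
finite quotients (Lyndon–Schupp, *Combinatorial Group Theory*, Ch. II §3) [cite: LyndonSchupp2001, Ch. II §3] as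
packaged by abc-iut-f-069's PL2-FOX files (`SettingModel.FoxLevel.lev/fox/alpha/beta`, `FoxChain.thetaHom`).

PROOF-ONLY file (no definition, no instance, no notation), abc-iut-L6-t19 (gen 21), for PROGRAMME P-L2 rung
(L3′), kernel slice 1 — the «tree-free remainder» item **CLAIM M** of the desk memo PL3-R1A (e1c32c715a30764d)
§2.3: for every `m ≥ 1`, if the `b`-line `g·b^Ẑ·g⁻¹` is stable under the pure-Kummer operators
`D′_t := Inn(b^t) ∘ s_{2t}` (`s_k = shear k : a ↦ a b^k, b ↦ b`) for all `t ∈ mℕ` — i.e.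
`g⁻¹ · b^t · s_{2t}(g) · b^{-t} ∈ b^Ẑ` — then `g ∈ b^Ẑ` (`mem_bAxis_of_forall_inv_mul_innB_shear_mem`; the converse
`inv_mul_innB_shear_mem_bAxis_of_mem` is immediate, so the stable set IS `b^Ẑ`:
`setOf_forall_inv_mul_innB_shear_mem_eq`; and ONE operator `Inn(b^m) ∘ s_{2m}` already suffices:
`mem_bAxis_of_inv_mul_innB_shear_mem`, via `inv_mul_innB_pow_shear_mem_bAxis`).  ROUTE (one-level Fox parity, the memo's (♣) sharpened): at an open
normal `V` with `n = ord π(b)`, `t = n·m`, coefficients `ℤ/2m`: the shear contributes `2m · Σ_j ρ_{A B^j} α_g = 0`,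
the conjugation by `b^t` contributes `m·(λ_{P⁻¹} N_B − N_B)` (`P = π g`, `N_B = Σ_{l<n} e_{B^l}`), and
`w ∈ b^Ẑ ∩ V` forces this to be a multiple `c·N_B`; evaluating at `P⁻¹` gives `m = 0` in `ℤ/2m` unless
`P ∈ ⟨π b⟩` (`exists_mem_bAxis_inv_mul_mem`); then compactness
(`ProfiniteGrp.exist_openNormalSubgroup_sub_open_nhds_of_one`, pattern of
`DehnTwist.mem_vertGp_of_forall_shearPow_pow_eq`).  Model-free (nothing about `hextΔ`/`hΘ` is stated or imported);
nothing of [EtTh] is asserted; no side is taken on [IUTchIII] Cor. 3.12.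
-/

noncomputable section

namespace Literature.AnabelianGeometry.EtaleTheta.SettingModel.KummerShear

open Literature.GroupTheory.CombinatorialGroupTheory.FoxChain
open Literature.AnabelianGeometry.EtaleTheta.SettingModel.FoxLevel
open Literature.AnabelianGeometry.AbsoluteAnabelian.AbsTopII
open Literature.AnabelianGeometry.SemiGraphs
open Literature.AnabelianGeometry.AbsoluteAnabelian

/-! ### Two pieces of bookkeeping: periodic sums, and vanishing of `2m • f` over `ℤ/2m` -/

/-- A sum of `n·q` terms of an `n`-periodic sequence is `q` times the sum over one period. [folklore] -/
private theorem sum_range_mul_of_periodic {M : Type*} [AddCommMonoid M] (F : ℕ → M) (n : ℕ)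
    (hF : ∀ j, F (j + n) = F j) (q : ℕ) :
    ∑ j ∈ Finset.range (n * q), F j = q • ∑ j ∈ Finset.range n, F j := by
  have hper : ∀ q j, F (n * q + j) = F j := by
    intro q
    induction q with
    | zero => intro j; rw [mul_zero, zero_add]
    | succ q ih => intro j; rw [Nat.mul_succ, show n * q + n + j = (n * q + j) + n by ring, hF, ih]
  induction q with
  | zero => rw [mul_zero, Finset.sum_range_zero, zero_nsmul]
  | succ q ih =>
    rw [Nat.mul_succ, Finset.sum_range_add, ih, add_nsmul, one_nsmul]
    congr 1
    exact Finset.sum_congr rfl fun j _ => hper q j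

/-- Over `ℤ/2m`, `(2m) • f = 0` for every coefficient function `f`. [folklore] -/
private theorem two_mul_nsmul_eq_zero {X : Type*} (m : ℕ) (f : X → ZMod (2 * m)) : (2 * m) • f = 0 := by
  funext x
  rw [Pi.smul_apply, Pi.zero_apply, nsmul_eq_mul, ZMod.natCast_self, zero_mul]

/-! ### The easy direction: `b^Ẑ` is stable -/

/-- The `b`-axis IS stable under every pure-Kummer operator: for `g ∈ b^Ẑ`,
`g⁻¹ · Inn(b^κ)(s_{κ²}(g)) ∈ b^Ẑ` (the shear fixes `b^Ẑ` pointwise). [cite: MochizukiEtTh2009, §1 p.13] -/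
theorem inv_mul_innB_shear_mem_bAxis_of_mem (κ : ZH) {g : F₂hatT} (hg : g ∈ bAxis) :
    g⁻¹ * innB κ (shear (κ ^ 2) g) ∈ bAxis := by
  obtain ⟨t, rfl⟩ := hg
  change (bPow t)⁻¹ * innB κ (shear (κ ^ 2) (bPow t)) ∈ bAxis
  rw [shear_bPow, innB_apply]
  exact bAxis.mul_mem (bAxis.inv_mem (bPow_mem_bAxis t))
    (bAxis.mul_mem (bAxis.mul_mem (bPow_mem_bAxis κ) (bPow_mem_bAxis t)) (bAxis.inv_mem (bPow_mem_bAxis κ)))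

/-! ### The finite-level computation -/

/-- **CLAIM M at a finite level.**  Let `m ≥ 1` and suppose `g⁻¹ · Inn(b^κ)(s_{κ²}(g)) ∈ b^Ẑ` for every `κ = ι(1)^t`,
`t ∈ mℕ`.  Then for every open normal subgroup `V` of `F̂₂` the image of `g` in `F̂₂/V` lies in the image of
`b^Ẑ`: there is `p ∈ b^Ẑ` with `p⁻¹ g ∈ V`.  (Fox homomorphism into `((ℤ/2m)^G × (ℤ/2m)^G) ⋊ G`, `G = F̂₂/V`,
`t = ord(π b)·m`; see the module docstring.) [cite: LyndonSchupp2001, Ch. II §3] -/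
theorem exists_mem_bAxis_inv_mul_mem {m : ℕ} (hm : 0 < m) {g : F₂hatT}
    (h : ∀ t : ℕ, m ∣ t → g⁻¹ * innB (iotaZ (Multiplicative.ofAdd 1) ^ t)
      (shear ((iotaZ (Multiplicative.ofAdd 1) ^ t) ^ 2) g) ∈ bAxis)
    (V : OpenNormalSubgroup F₂hatT) : ∃ p ∈ bAxis, p⁻¹ * g ∈ V := by
  classical
  -- the finite quotient `G = F̂₂ / V`, its generators `A, B`, `n = ord B`, `P = π g`
  haveI : Finite (F₂hatT ⧸ V.toSubgroup) := Subgroup.quotient_finite_of_isOpen _ V.toOpenSubgroup.isOpen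
  letI : Fintype (F₂hatT ⧸ V.toSubgroup) := Fintype.ofFinite _
  set π : F₂hatT →* F₂hatT ⧸ V.toSubgroup := QuotientGroup.mk' V.toSubgroup with hπ_def
  set A : F₂hatT ⧸ V.toSubgroup := π (eta (FreeGroup.of 0)) with hA
  set B : F₂hatT ⧸ V.toSubgroup := π (eta (FreeGroup.of 1)) with hB
  have hlev : lev A B = π := by
    rw [hA, hB]
    refine lev_apply_eq_self π ?_
    rw [hπ_def, QuotientGroup.ker_mk']
    exact V.toOpenSubgroup.isOpen
  -- `n = ord B` (kept OPAQUE: `orderOf` must never be unfolded by `whnf`)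
  obtain ⟨n, hn_def⟩ : ∃ n : ℕ, orderOf B = n := ⟨_, rfl⟩
  have hn : 0 < n := hn_def ▸ orderOf_pos B
  have hBn : B ^ n = 1 := by rw [← hn_def]; exact pow_orderOf_eq_one B
  obtain ⟨P, hP⟩ : ∃ P : F₂hatT ⧸ V.toSubgroup, π g = P := ⟨_, rfl⟩
  have hlev_g : lev A B g = P := by rw [hlev, hP]
  -- the level `t = n·m`, `κ = ι(1)^t`, `b^κ = b^t`, `π(b^t) = 1`
  obtain ⟨t, ht_def⟩ : ∃ t : ℕ, n * m = t := ⟨_, rfl⟩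
  obtain ⟨κ, hκ_def⟩ : ∃ κ : ZH, iotaZ (Multiplicative.ofAdd 1) ^ t = κ := ⟨_, rfl⟩
  have hbκ : bPow κ = eta (FreeGroup.of 1) ^ t := by rw [← hκ_def, map_pow, bPow_iotaZ_one]
  have hbκ2 : bPow (κ ^ 2) = eta (FreeGroup.of 1) ^ (t * 2) := by rw [map_pow, hbκ, ← pow_mul]
  have hBt : B ^ t = 1 := by rw [← ht_def, pow_mul, hBn, one_pow]
  have hBt2 : B ^ (t * 2) = 1 := by rw [pow_mul, hBt, one_pow]
  have hlev_bt : lev A B (bPow κ) = 1 := by rw [hlev, hbκ, map_pow, ← hB, hBt]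
  -- the hypothesis at `t`: `w := g⁻¹ · (b^t · s_{2t}(g) · b^{-t}) = b^z ∈ b^Ẑ`
  have hw := h t (ht_def ▸ Dvd.intro_left n rfl)
  rw [hκ_def, innB_apply] at hw
  obtain ⟨z, hz⟩ := hw
  change bPow z = _ at hz
  -- coefficients `ℤ/2m` and the Fox homomorphism `ψ = fox A B`
  haveI : NeZero (2 * m) := ⟨by omega⟩
  haveI : Finite (W (F₂hatT ⧸ V.toSubgroup) (ZMod (2 * m))) := DehnTwist.finite_W
  -- (i) the chain rule for the shear `s_{κ²} : a ↦ a b^{2t}`: `ψ ∘ s_{κ²} = Θ_{2t} ∘ ψ`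
  have hchain : ∀ x : F₂hatT, fox (k := ZMod (2 * m)) A B (shearEnd (κ ^ 2) x) =
      thetaHom A B (t * 2) (fox A B x) := by
    letI : TopologicalSpace (W (F₂hatT ⧸ V.toSubgroup) (ZMod (2 * m))) := ⊥
    haveI : DiscreteTopology (W (F₂hatT ⧸ V.toSubgroup) (ZMod (2 * m))) := ⟨rfl⟩
    let Θc : W (F₂hatT ⧸ V.toSubgroup) (ZMod (2 * m)) →ₜ* W (F₂hatT ⧸ V.toSubgroup) (ZMod (2 * m)) :=
      ⟨thetaHom A B (t * 2), continuous_of_discreteTopology⟩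
    have hc : (foxC (k := ZMod (2 * m)) A B).comp (shearEnd (κ ^ 2)) = Θc.comp (foxC A B) := by
      refine ext_of_eta ?_ ?_
      · show fox (k := ZMod (2 * m)) A B (shearEnd (κ ^ 2) (eta (FreeGroup.of 0))) =
          thetaHom A B (t * 2) (fox (k := ZMod (2 * m)) A B (eta (FreeGroup.of 0)))
        rw [shearEnd_eta_of_zero, map_mul, hbκ2, map_pow, fox_genA, fox_genB, thetaHom_wa A B (t * 2) hBt2]
      · show fox (k := ZMod (2 * m)) A B (shearEnd (κ ^ 2) (eta (FreeGroup.of 1))) =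
          thetaHom A B (t * 2) (fox (k := ZMod (2 * m)) A B (eta (FreeGroup.of 1)))
        rw [shearEnd_eta_of_one, fox_genB, thetaHom_wb]
    intro x
    exact DFunLike.congr_fun hc x
  -- consequences: `π ∘ s = π`, and `β_{s g} = β_g` over `ℤ/2m` (the shear term is `2m • (…) = 0`)
  have hlev_shear : lev A B (shear (κ ^ 2) g) = P := by
    rw [shear_apply, ← fox_right (k := ZMod (2 * m)), hchain, thetaHom_apply]
    show (fox (k := ZMod (2 * m)) A B g).right = P
    rw [fox_right, hlev_g]
  have hbeta_shear : beta (k := ZMod (2 * m)) A B (shear (κ ^ 2) g) = beta A B g := by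
    have h1 : beta (k := ZMod (2 * m)) A B (shear (κ ^ 2) g) =
        beta A B g + ∑ j ∈ Finset.range (t * 2), rt (A * B ^ j) (alpha (k := ZMod (2 * m)) A B g) := by
      rw [shear_apply, beta_def, beta_def, alpha_def, hchain, thetaHom_apply]
      rfl
    have hsum : ∑ j ∈ Finset.range (t * 2), rt (A * B ^ j) (alpha (k := ZMod (2 * m)) A B g) = 0 := by
      rw [← ht_def, mul_assoc, sum_range_mul_of_periodic (fun j => rt (A * B ^ j) (alpha (k := ZMod (2 * m)) A B g))
        n (fun j => by simp only [pow_add, hBn, mul_one]) (m * 2), mul_comm m 2]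
      exact two_mul_nsmul_eq_zero m _
    rw [h1, hsum, add_zero]
  -- the `b`-chain of `b^t`: `β(b^t) = m • N_B`
  obtain ⟨N, hN_def⟩ : ∃ N : (F₂hatT ⧸ V.toSubgroup) → ZMod (2 * m), ∑ l ∈ Finset.range n, e (B ^ l) = N :=
    ⟨_, rfl⟩
  have hperN : ∀ j, (e (B ^ (j + n)) : (F₂hatT ⧸ V.toSubgroup) → ZMod (2 * m)) = e (B ^ j) := fun j => by
    simp only [pow_add, hBn, mul_one]
  have hbeta_bt : beta (k := ZMod (2 * m)) A B (bPow κ) = m • N := by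
    rw [hbκ, beta_pow A B (eta (FreeGroup.of 1)) t, hlev, ← hB, beta_genB, ← ht_def]
    have h1 : ∀ i, lt (B ^ i) (e 1 : (F₂hatT ⧸ V.toSubgroup) → ZMod (2 * m)) = e (B ^ i) := fun i => by
      rw [lt_e, mul_one]
    simp only [h1]
    rw [sum_range_mul_of_periodic _ n hperN m, hN_def]
  -- (ii) `β_w` by the product rule: `β_w = λ_{P⁻¹}(m • N) - m • N`
  have hβ1 : beta (k := ZMod (2 * m)) A B (bPow κ * shear (κ ^ 2) g) = m • N + beta A B g := by
    rw [beta_mul A B (bPow κ) (shear (κ ^ 2) g), hbeta_bt, hlev_bt, lt_one, hbeta_shear]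
  have hβ2 : beta (k := ZMod (2 * m)) A B (bPow κ * shear (κ ^ 2) g * (bPow κ)⁻¹) =
      m • N + beta A B g - lt P (m • N) := by
    rw [beta_mul A B (bPow κ * shear (κ ^ 2) g) (bPow κ)⁻¹, hβ1, map_mul, hlev_bt, hlev_shear, one_mul,
      beta_inv A B (bPow κ), hlev_bt, inv_one, lt_one, hbeta_bt,
      Literature.GroupTheory.CombinatorialGroupTheory.FoxChain.lt_neg, sub_eq_add_neg]
  have hbeta_w : beta (k := ZMod (2 * m)) A B (g⁻¹ * (bPow κ * shear (κ ^ 2) g * (bPow κ)⁻¹)) =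
      lt P⁻¹ (m • N) - m • N := by
    rw [beta_mul A B g⁻¹ (bPow κ * shear (κ ^ 2) g * (bPow κ)⁻¹), beta_inv A B g, map_inv, hlev_g, hβ2,
      lt_sub, lt_add, ← lt_mul, inv_mul_cancel, lt_one]
    abel
  -- (iii) `β_w` from `w = b^z ∈ b^Ẑ ∩ V`: `β_w = c • N`
  obtain ⟨E, hE⟩ : ∃ E : ℕ+, ∀ w : W (F₂hatT ⧸ V.toSubgroup) (ZMod (2 * m)), w ^ (E : ℕ) = 1 :=
    ⟨⟨Monoid.exponent (W (F₂hatT ⧸ V.toSubgroup) (ZMod (2 * m))), Monoid.ExponentExists.of_finite.exponent_pos⟩,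
      fun w => Monoid.pow_exponent_eq_one w⟩
  obtain ⟨r, hr_def⟩ : ∃ r : ℕ, (Multiplicative.toAdd (ZHatLevel.level E z)).val = r := ⟨_, rfl⟩
  have hfox_w : fox (k := ZMod (2 * m)) A B (bPow z) = wb B ^ r := hr_def ▸ fox_bPow A B E hE z
  have hlev_w : lev A B (bPow z) = 1 := by
    rw [hz, map_mul, map_inv, hlev_g, map_mul, map_mul, map_inv, hlev_bt, hlev_shear]
    simp only [one_mul, inv_one, mul_one, inv_mul_cancel]
  have hBr : B ^ r = 1 := by
    have h1 := fox_right (k := ZMod (2 * m)) A B (bPow z)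
    rw [hfox_w, hlev_w, wb_pow] at h1
    exact h1
  obtain ⟨c, hc⟩ : n ∣ r := hn_def ▸ orderOf_dvd_of_pow_eq_one hBr
  have hbeta_w' : beta (k := ZMod (2 * m)) A B (bPow z) = c • N := by
    rw [beta_def, hfox_w, wb_pow]
    show ∑ l ∈ Finset.range r, (e (B ^ l) : (F₂hatT ⧸ V.toSubgroup) → ZMod (2 * m)) = c • N
    rw [hc, ← hN_def]
    exact sum_range_mul_of_periodic _ n hperN c
  -- (iv) compare the two computations at the point `P⁻¹`
  have hcmp : lt P⁻¹ (m • N) - m • N = c • N := by rw [← hbeta_w, ← hbeta_w', hz]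
  have hN1 : N 1 = 1 := by
    rw [← hN_def, Finset.sum_apply, Finset.sum_eq_single_of_mem 0 (Finset.mem_range.mpr hn)]
    · simp [e]
    · intro l hl hl0
      have hl' : l < n := Finset.mem_range.mp hl
      have hne : (1 : F₂hatT ⧸ V.toSubgroup) ≠ B ^ l := by
        intro h1
        exact hl0 (Nat.eq_zero_of_dvd_of_lt (hn_def ▸ orderOf_dvd_of_pow_eq_one h1.symm) hl')
      simp [e, hne]
  by_cases hPB : P ∈ Subgroup.zpowers B
  · -- `π g = π(b)^i`: take `p = b^i`
    obtain ⟨i, hi⟩ := Subgroup.mem_zpowers_iff.mp hPB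
    refine ⟨eta (FreeGroup.of 1) ^ i, bAxis.zpow_mem eta_of_one_mem_bAxis i, QuotientGroup.eq.mp ?_⟩
    show π (eta (FreeGroup.of 1) ^ i) = π g
    rw [map_zpow, ← hB, hi, hP]
  · -- otherwise `N` vanishes at `P⁻¹` and the comparison reads `m = 0` in `ℤ/2m`
    exfalso
    have hNP : N P⁻¹ = 0 := by
      rw [← hN_def, Finset.sum_apply]
      refine Finset.sum_eq_zero fun l _ => ?_
      have hne : P⁻¹ ≠ B ^ l := by
        intro h1
        apply hPB
        rw [← inv_inv P, h1, ← zpow_natCast, ← zpow_neg]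
        exact Subgroup.zpow_mem_zpowers B _
      simp [e, hne]
    have hval := congrFun hcmp P⁻¹
    rw [Pi.sub_apply, lt_apply, inv_inv, mul_inv_cancel, Pi.smul_apply, Pi.smul_apply, Pi.smul_apply, hN1, hNP,
      smul_zero, smul_zero, sub_zero, nsmul_eq_mul, mul_one] at hval
    have hm2 : 2 * m ∣ m := (ZMod.natCast_eq_zero_iff m (2 * m)).mp hval
    have := Nat.le_of_dvd hm hm2
    omega

/-! ### One operator suffices: stability under `D′_κ` propagates to its iterates `D′_{κ^j}` -/

/-- The iterates of one pure-Kummer operator: `(Inn(b^κ) ∘ s_{κ²})^{j} = Inn(b^{κ^j}) ∘ s_{(κ^j)²}` (`Inn(b^·)` and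
the shears commute, `shear_innB`; both are flows). [cite: MochizukiEtTh2009, §1 p.13] -/
theorem innB_shear_iterate (κ : ZH) (j : ℕ) (x : F₂hatT) :
    (fun y => innB κ (shear (κ ^ 2) y))^[j] x = innB (κ ^ j) (shear ((κ ^ j) ^ 2) x) := by
  induction j generalizing x with
  | zero => rw [Function.iterate_zero_apply, pow_zero, one_pow, shear_one, innB_one]
  | succ j ih =>
    rw [Function.iterate_succ_apply', ih, shear_innB, ← innBHom_apply, ← innBHom_apply (κ ^ j), ← MulAut.mul_apply,
      ← map_mul, innBHom_apply, ← shear_mul, ← pow_succ', ← pow_mul, ← pow_add, ← pow_mul,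
      show 2 + j * 2 = (j + 1) * 2 by ring]

/-- If the `b`-line of `g` is stable under ONE pure-Kummer operator `D′_κ = Inn(b^κ) ∘ s_{κ²}`
(`g⁻¹ · D′_κ(g) ∈ b^Ẑ`), it is stable under all its iterates: `g⁻¹ · D′_{κ^j}(g) ∈ b^Ẑ` (`D′` is multiplicative and
fixes `b^Ẑ` pointwise). [cite: MochizukiEtTh2009, §1 p.13] -/
theorem inv_mul_innB_pow_shear_mem_bAxis (κ : ZH) {g : F₂hatT} (hg : g⁻¹ * innB κ (shear (κ ^ 2) g) ∈ bAxis)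
    (j : ℕ) : g⁻¹ * innB (κ ^ j) (shear ((κ ^ j) ^ 2) g) ∈ bAxis := by
  rw [← innB_shear_iterate]
  induction j with
  | zero => rw [Function.iterate_zero_apply, inv_mul_cancel]; exact bAxis.one_mem
  | succ j ih =>
    obtain ⟨s, hs⟩ := ih
    change bPow s = _ at hs
    have hstep : (fun y => innB κ (shear (κ ^ 2) y))^[j + 1] g = innB κ (shear (κ ^ 2) g) * bPow s := by
      rw [Function.iterate_succ_apply', show (fun y => innB κ (shear (κ ^ 2) y))^[j] g = g * bPow s by
        rw [hs, mul_inv_cancel_left], map_mul, map_mul, shear_bPow, innB_bPow]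
    rw [hstep, ← mul_assoc]
    exact bAxis.mul_mem hg (bPow_mem_bAxis s)

/-! ### CLAIM M -/

/-- **CLAIM M (PL3-R1A §2.3): the pure-Kummer operators stabilise no `b`-line but `b^Ẑ`.**  Let `m ≥ 1` and
`g ∈ F̂₂`.  If `g⁻¹ · Inn(b^κ)(s_{κ²}(g)) ∈ b^Ẑ` for every `κ = ι(1)^t` with `m ∣ t` (i.e. the `b`-line `g b^Ẑ g⁻¹`
is stable under `Inn(b^t) ∘ shear(2t)` for all `t ∈ mℕ`), then `g ∈ b^Ẑ`. [cite: LyndonSchupp2001, Ch. II §3] -/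
theorem mem_bAxis_of_forall_inv_mul_innB_shear_mem {m : ℕ} (hm : 0 < m) {g : F₂hatT}
    (h : ∀ t : ℕ, m ∣ t → g⁻¹ * innB (iotaZ (Multiplicative.ofAdd 1) ^ t)
      (shear ((iotaZ (Multiplicative.ofAdd 1) ^ t) ^ 2) g) ∈ bAxis) :
    g ∈ bAxis := by
  by_contra hx
  set S : Set F₂hatT := (fun p : F₂hatT => p⁻¹ * g) '' (bAxis : Set F₂hatT) with hS_def
  have hS : IsCompact S := isClosed_bAxis.isCompact.image (continuous_id.inv.mul continuous_const)
  have h1S : (1 : F₂hatT) ∈ Sᶜ := by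
    rintro ⟨p, hp, hpx⟩
    apply hx
    have hpg : p = g := inv_mul_eq_one.mp hpx
    rw [← hpg]
    exact hp
  obtain ⟨V, hV⟩ := ProfiniteGrp.exist_openNormalSubgroup_sub_open_nhds_of_one hS.isClosed.isOpen_compl h1S
  obtain ⟨p, hp, hpV⟩ := exists_mem_bAxis_inv_mul_mem hm h V
  exact hV hpV ⟨p, hp, rfl⟩

/-- **CLAIM M, subgroup form** (the shape consumed downstream: `M ⊆ Ẑ` any subgroup containing `ι(1)^m` for some
`m ≥ 1`, e.g. an open subgroup): if `g⁻¹ · Inn(b^κ)(s_{κ²}(g)) ∈ b^Ẑ` for all `κ ∈ M`, then `g ∈ b^Ẑ`.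
[cite: LyndonSchupp2001, Ch. II §3] -/
theorem mem_bAxis_of_forall_mem_inv_mul_innB_shear_mem {m : ℕ} (hm : 0 < m) (M : Subgroup ZH)
    (hM : iotaZ (Multiplicative.ofAdd 1) ^ m ∈ M) {g : F₂hatT}
    (h : ∀ κ ∈ M, g⁻¹ * innB κ (shear (κ ^ 2) g) ∈ bAxis) : g ∈ bAxis := by
  refine mem_bAxis_of_forall_inv_mul_innB_shear_mem hm fun t ht => h _ ?_
  obtain ⟨j, rfl⟩ := ht
  rw [pow_mul]
  exact M.pow_mem hM j

/-- **CLAIM M, one-operator form**: if `g⁻¹ · Inn(b^m)(s_{2m}(g)) ∈ b^Ẑ` for ONE `m ≥ 1` (`b^m = b^{ι(1)^m}`), then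
`g ∈ b^Ẑ` — the `b`-line `b^Ẑ` is the only one stable under `Inn(b^m) ∘ shear(2m)`. [cite: LyndonSchupp2001, Ch. II §3] -/
theorem mem_bAxis_of_inv_mul_innB_shear_mem {m : ℕ} (hm : 0 < m) {g : F₂hatT}
    (hg : g⁻¹ * innB (iotaZ (Multiplicative.ofAdd 1) ^ m)
      (shear ((iotaZ (Multiplicative.ofAdd 1) ^ m) ^ 2) g) ∈ bAxis) : g ∈ bAxis := by
  refine mem_bAxis_of_forall_inv_mul_innB_shear_mem hm fun t ht => ?_
  obtain ⟨j, rfl⟩ := ht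
  rw [pow_mul]
  exact inv_mul_innB_pow_shear_mem_bAxis _ hg j

/-- **CLAIM M as an equality of sets**: `{g : ∀ t ∈ mℕ, g⁻¹·Inn(b^t)(s_{2t} g) ∈ b^Ẑ} = b^Ẑ` (`m ≥ 1`).
[cite: LyndonSchupp2001, Ch. II §3] -/
theorem setOf_forall_inv_mul_innB_shear_mem_eq {m : ℕ} (hm : 0 < m) :
    {g : F₂hatT | ∀ t : ℕ, m ∣ t → g⁻¹ * innB (iotaZ (Multiplicative.ofAdd 1) ^ t)
      (shear ((iotaZ (Multiplicative.ofAdd 1) ^ t) ^ 2) g) ∈ bAxis} = (bAxis : Set F₂hatT) := by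
  ext g
  exact ⟨fun hg => mem_bAxis_of_forall_inv_mul_innB_shear_mem hm hg,
    fun hg t _ => inv_mul_innB_shear_mem_bAxis_of_mem _ hg⟩

end Literature.AnabelianGeometry.EtaleTheta.SettingModel.KummerShear

end
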